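import Mathlib.MeasureTheory.Measure.Decomposition.RadonNikodym
import Mathlib.MeasureTheory.VectorMeasure.Decomposition.RadonNikodym
import Literature.MathematicalPhysics.KineticTheory.LambertianHardSphereFlow
import HarnessLib

/-!
# The marked contact Campbell measure of the Lambertian gas and its Campbell-conditional
# response kernel

Topic `Literature/MathematicalPhysics/KineticTheory` (definition item
`defn-LambertianContactResponseKernel`, wanted by the item `LambertianLinearResponse`
(stmt-AtomisticToContinuum-12488) of `AtomisticToContinuum/HydrodynamicLimit`, route
`LambertianContactSwap`, crux `SwapGap`: the object needed to TYPE the `Λ`-side child of the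
native Lindeberg split non-degenerately — "`Λ`'s own Campbell-conditional response").

Everything is built over the named API of `LambertianHardSphereFlow` (the Lambertian recursion
`lambertStateAfter / lambertInstant / lambertFlow` driven by the noise `lambertNoise`), for a
general geometry `G : Geometry d X` and diameter `ε` (the routes use `G = Torus.geometry (Fin 3)`,
`ε = hsDiameter σ N`), and for a general INITIAL LAW `μ` on configurations (the routes use
`μ = localGibbsLaw …`; a deterministic start `y` is `μ = Measure.dirac y`).  The sample space is
`Ω = Config N d X × (ℕ → ℝ^d)` with the law `μ ⊗ lambertNoise d` of (initial datum, noise).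

* `lambertPre G ε ξs z m` — the pre-collisional configuration of the `(m+1)`-th collision:
  the `m`-th post-collisional state flown freely up to its exit time (the configuration whose
  incoming contact pair `lambertStep` redraws with the noise `ξs m`).
* `contactMarks G ε i j y ξ ∈ X × ℝ^d × ℝ × ℝ^d × ℝ^d` — the marks of the contact of the pair
  `(i, j)` in `y` redrawn with `ξ`: contact midpoint `x_j + (x_i - x_j)/2`, centre-of-mass
  velocity `c = (v_i + v_j)/2`, relative speed `r = |v_i - v_j|`, unit contact normal
  `ω = ε⁻¹ (x_i - x_j)`, OUTGOING relative direction `n = lambertDir (x_i - x_j) ξ` (so that the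
  redrawn pair has `v_i' - v_j' = r n`, `vel_sub_vel_lambertPair`); `contactMarksOfPairs G ε S y ξ`
  — the same for the pair `S.some` selected by `lambertStep` from the set `S` of incoming pairs
  (junk `0` if `S = ∅`).
* `lambertMarks G ε ξs z m : CollisionMarks d X = ℝ × X × ℝ^d × ℝ × ℝ^d × ℝ^d` — the marks of
  the `m`-th collision (`m = 0, 1, …`; it happens at the instant `t_{m+1} = lambertInstant … (m+1)`):
  `(t_{m+1}, x_m, c_m, r_m, ω_m, n_m)`.  Jointly measurable in `(z, ξs)`
  (`measurable_lambertMarks`).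
* `lambertCampbell G ε μ s : Measure (CollisionMarks d X)` — the **marked contact Campbell
  (intensity) measure** of the collisions in `[0, s]`:
  `A ↦ E_{μ ⊗ γ^ℕ} #{m : t_{m+1} ≤ s, lambertMarks … m ∈ A}` — the intensity measure of the
  marked collision point process (Last–Penrose, Def. 2.5; Kallenberg), written as the countable
  sum over `m` of the images of `(μ ⊗ γ^ℕ)|_{t_{m+1} ≤ s}` under the `m`-th marks
  (`lambertCampbell_apply`: Campbell's formula for indicators).  Its total mass is the expected
  number of collisions in `[0, s]` (`lambertCampbell_univ`), so it is finite under a first-moment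
  bound on the collision count (`isFiniteMeasure_lambertCampbell`).
* `lambertWeightedCampbell G ε μ s g` — the same with each collision weighted by
  `g(Λ_s(z, ξs)) ∈ [0, ∞]`, a function of the FINAL state of the trajectory; dominated by
  `(sup g) • lambertCampbell` and absolutely continuous with respect to it
  (`lambertWeightedCampbell_le_smul`, `lambertWeightedCampbell_absolutelyContinuous`).
* `lambertResponseKernel G ε μ s F : CollisionMarks d X → ℝ` — for a real observable `F` of the
  final state, the Radon–Nikodym derivative `d(Γ_{F⁺})/dΓ - d(Γ_{F⁻})/dΓ` of the weighted
  Campbell measures of `F^±` with respect to the Campbell measure `Γ`: **`Λ`'s own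
  Campbell-conditional response** `Ψ^Λ(t, x, c, r, ω, n)` = the conditional mean of `F(Λ_s)` given
  that a collision with marks `(t, x, c, r, ω)` went out in direction `n`.  Measurable
  (`measurable_lambertResponseKernel`), `|Ψ^Λ| ≤ sup |F|` `Γ`-a.e. for finite `Γ`
  (`abs_lambertResponseKernel_le_ae`).
* `lambertResponseMeasure G ε μ s F : SignedMeasure (CollisionMarks d X)` — the **response signed
  measure** `Γ.withDensityᵥ Ψ^Λ`; absolutely continuous w.r.t. `Γ`
  (`lambertResponseMeasure_absolutelyContinuous`), with Radon–Nikodym derivative `Ψ^Λ`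
  (`lambertResponseKernel_ae_eq_rnDeriv`), and given on measurable `A` by the **Campbell response
  formula** `∑_m E[1{t_{m+1} ≤ s, marks_m ∈ A} · F(Λ_s)]` for bounded measurable `F` and finite `Γ`
  (`lambertResponseMeasure_apply`) — the formula by which the item defines it.

## Design choices

* Initial LAW rather than initial point: the consumer evaluates `Ψ^Λ` "under the Lambertian gas
  started from `P_N`"; with `μ = Measure.dirac y` all objects are those of the trajectory from `y`.
* The time cut-off `t_{m+1} ≤ s` is imposed in the Campbell sum, not in the marks: `lambertMarks`
  is defined for every `m` (past the last collision before `s` it still returns the marks of the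
  later collisions, and the documented junk once the recursion stops), so that it does not depend
  on the horizon.  `#{m : t_{m+1} ≤ s}` is the honest number of collisions in `[0, s]` (it is
  `lambertCount` off the Zeno event where the instants accumulate before `s`, on which it is `∞`
  and the Campbell measure is infinite, while `lambertCount` has the junk value `0`).
* The kernel is defined through the two MEASURES `Γ_{F^±}` (`ENNReal`-valued weights and
  `Measure.rnDeriv`), and the signed response measure as `Γ.withDensityᵥ Ψ^Λ`; absolute continuity
  and "kernel = `rnDeriv`" are then theorems of the general theory, and the content is the Campbell
  response formula `lambertResponseMeasure_apply`.
* Junk values, documented: `contactMarksOfPairs … ∅ … = 0` (no incoming pair at the exit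
  configuration — grazing exits, or `m` past the last collision, where also `t_{m+1} = ∞` has
  `toReal = 0`); `lambertDir = 0` on its Gaussian-null junk ray; the position junk needs `[Zero X]`
  (the torus and `ℝ^d` qualify); `rnDeriv` and hence `Ψ^Λ` are determined only `Γ`-a.e.
* NOT here (problem-side): the `N + 1 = 2` sanity computation asked for by the item ("Campbell
  measure = law of the single collision's marks") is false as stated on the torus for large
  horizons (a pair re-collides after winding), and any statement about the law of the marks
  under `localGibbsLaw` belongs to the routes; finiteness of the expected collision count is the
  route item `CollisionMomentBound` (stmt-AtomisticToContinuum-12102), here a hypothesis.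

## References

* G. Last, M. Penrose, *Lectures on the Poisson Process*, CUP (2017): Def. 2.5 (intensity
  measure), Prop. 2.7 (Campbell's formula), (13.1) (random measures). [LastPenrose2017]
* O. Kallenberg, *Foundations of Modern Probability*, 3rd ed. (2021), Ch. 31 (Palm and Campbell
  measures). [Kallenberg2021]
* C. Cercignani, R. Illner, M. Pulvirenti, *The Mathematical Theory of Dilute Gases* (1994),
  App. 4.A (the collision-by-collision construction the marks are read off). [CIP1994]
-/

noncomputable section

open MeasureTheory Set Function Filter
open scoped ENNReal

namespace Literature.MathematicalPhysics.KineticTheory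

open Literature.Analysis.FluidPDE Literature.Analysis.FluidPDE.Alexander

/-! ## The marks of a collision -/

section Marks

variable {d : Type*} [Fintype d] {X : Type*} {N : ℕ}

/-- The **mark space** of a collision of the Lambertian gas: instant, contact midpoint,
centre-of-mass velocity, relative speed, unit contact normal, outgoing relative direction —
`(t, x, c, r, ω, n) ∈ ℝ × X × ℝ^d × ℝ × ℝ^d × ℝ^d`. [folklore] -/
abbrev CollisionMarks (d : Type*) [Fintype d] (X : Type*) : Type _ :=
  ℝ × X × EuclideanSpace ℝ d × ℝ × EuclideanSpace ℝ d × EuclideanSpace ℝ d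

variable (G : Geometry d X) (ε : ℝ)

/-- The **pre-collisional configuration of the `(m+1)`-th collision** of the Lambertian recursion:
the `m`-th post-collisional state `z_m` flown freely up to its exit time `τ(z_m)` — the
configuration whose incoming contact pair `lambertStep` redraws with the noise `ξs m`
(`lambertStateAfter_succ`, `lambertStep_of_ne_top`). Junk: `z_m` itself if `τ(z_m) = ∞`.
[cite: CIP1994, App. 4.A p. 111] -/
def lambertPre (ξs : ℕ → EuclideanSpace ℝ d) (z : Config N d X) (m : ℕ) : Config N d X :=
  freeFlight G (freeExitTime G ε (lambertStateAfter G ε ξs z m)).toReal (lambertStateAfter G ε ξs z m)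

/-- Unfolding lemma for `lambertPre`. [folklore] -/
theorem lambertPre_def (ξs : ℕ → EuclideanSpace ℝ d) (z : Config N d X) (m : ℕ) :
    lambertPre G ε ξs z m = freeFlight G (freeExitTime G ε (lambertStateAfter G ε ξs z m)).toReal
      (lambertStateAfter G ε ξs z m) := rfl

/-- `z_{m+1}` is the Lambertian redraw, selected by `lambertStepMap` from the incoming pairs, of
the pre-collisional configuration of the `(m+1)`-th collision (when `τ(z_m) < ∞`). [folklore] -/
theorem lambertStateAfter_succ_eq_lambertStepMap {ξs : ℕ → EuclideanSpace ℝ d} {z : Config N d X}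
    {m : ℕ} (h : freeExitTime G ε (lambertStateAfter G ε ξs z m) ≠ ∞) :
    lambertStateAfter G ε ξs z (m + 1) =
      lambertStepMap G (incomingPairs G ε (lambertPre G ε ξs z m)) (lambertPre G ε ξs z m) (ξs m) := by
  rw [lambertStateAfter_succ, lambertStep_of_ne_top h, lambertPre]

/-- The **marks of the contact of the pair `(i, j)`** in the configuration `y`, redrawn with the
noise `ξ`: contact midpoint `x_j + (x_i - x_j)/2`, centre-of-mass velocity `(v_i + v_j)/2`,
relative speed `|v_i - v_j|`, unit contact normal `ε⁻¹ (x_i - x_j)` (a unit vector on the contact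
set `|x_i - x_j| = ε`), and the OUTGOING relative direction `lambertDir (x_i - x_j) ξ` of the
Lambertian redraw (`vel_sub_vel_lambertPair`: `v_i' - v_j' = |v_i - v_j| · lambertDir (x_i - x_j) ξ`).
[cite: CometsEtAl2008, §2.1] -/
def contactMarks (i j : Fin N) (y : Config N d X) (ξ : EuclideanSpace ℝ d) :
    X × EuclideanSpace ℝ d × ℝ × EuclideanSpace ℝ d × EuclideanSpace ℝ d :=
  (G.translate (y j).1 ((2 : ℝ)⁻¹ • G.sepVec (y i).1 (y j).1), (2 : ℝ)⁻¹ • ((y i).2 + (y j).2),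
    ‖(y i).2 - (y j).2‖, ε⁻¹ • G.sepVec (y i).1 (y j).1, lambertDir (G.sepVec (y i).1 (y j).1) ξ)

/-- Unfolding lemma for `contactMarks`. [folklore] -/
theorem contactMarks_def (i j : Fin N) (y : Config N d X) (ξ : EuclideanSpace ℝ d) :
    contactMarks G ε i j y ξ =
      (G.translate (y j).1 ((2 : ℝ)⁻¹ • G.sepVec (y i).1 (y j).1), (2 : ℝ)⁻¹ • ((y i).2 + (y j).2),
        ‖(y i).2 - (y j).2‖, ε⁻¹ • G.sepVec (y i).1 (y j).1,
        lambertDir (G.sepVec (y i).1 (y j).1) ξ) := rfl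

/-- **The marks determine the redrawn relative velocity**: after the Lambertian redraw of `(i, j)`,
`v_i' - v_j' = r • n` with `r`, `n` the speed and direction marks. [folklore] -/
theorem vel_sub_vel_lambertPair_eq_marks {i j : Fin N} (hij : i ≠ j) (y : Config N d X)
    (ξ : EuclideanSpace ℝ d) :
    (lambertPair G i j y ξ i).2 - (lambertPair G i j y ξ j).2 =
      (contactMarks G ε i j y ξ).2.2.1 • (contactMarks G ε i j y ξ).2.2.2.2 :=
  vel_sub_vel_lambertPair hij y ξ

open Classical in
/-- The marks of the contact of the pair `S.some` selected (as `lambertStepMap` does) from a set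
`S` of pairs; junk `0` if `S` is empty. [folklore] -/
def contactMarksOfPairs [Zero X] (S : Set (Fin N × Fin N)) (y : Config N d X)
    (ξ : EuclideanSpace ℝ d) : X × EuclideanSpace ℝ d × ℝ × EuclideanSpace ℝ d × EuclideanSpace ℝ d :=
  if h : S.Nonempty then contactMarks G ε h.some.1 h.some.2 y ξ else 0

/-- For a singleton set of pairs the selected marks are the marks of that pair. [folklore] -/
theorem contactMarksOfPairs_singleton [Zero X] (p : Fin N × Fin N) (y : Config N d X)
    (ξ : EuclideanSpace ℝ d) :
    contactMarksOfPairs G ε {p} y ξ = contactMarks G ε p.1 p.2 y ξ := by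
  have h : ({p} : Set (Fin N × Fin N)).Nonempty := singleton_nonempty p
  rw [contactMarksOfPairs, dif_pos h, mem_singleton_iff.1 h.some_mem]

/-- For the empty set of pairs the selected marks are the junk value `0`. [folklore] -/
theorem contactMarksOfPairs_empty [Zero X] (y : Config N d X) (ξ : EuclideanSpace ℝ d) :
    contactMarksOfPairs G ε (∅ : Set (Fin N × Fin N)) y ξ = 0 := by
  rw [contactMarksOfPairs, dif_neg Set.not_nonempty_empty]

/-- **The marks of the `m`-th collision** of the Lambertian trajectory driven by `ξs` from `z`
(`m = 0, 1, 2, …`; the `m`-th collision happens at the instant `t_{m+1} = lambertInstant … (m+1)`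
and is redrawn with `ξs m`): `(t_{m+1}, x_m, c_m, r_m, ω_m, n_m)` — the instant (as a real
number; junk `0` if infinite) and the contact marks of the pair selected by the step in the
pre-collisional configuration `lambertPre … m`. [cite: CIP1994, App. 4.A p. 111] -/
def lambertMarks [Zero X] (ξs : ℕ → EuclideanSpace ℝ d) (z : Config N d X) (m : ℕ) :
    CollisionMarks d X :=
  ((lambertInstant G ε ξs z (m + 1)).toReal,
    contactMarksOfPairs G ε (incomingPairs G ε (lambertPre G ε ξs z m)) (lambertPre G ε ξs z m) (ξs m))

/-- Unfolding lemma for `lambertMarks`. [folklore] -/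
theorem lambertMarks_def [Zero X] (ξs : ℕ → EuclideanSpace ℝ d) (z : Config N d X) (m : ℕ) :
    lambertMarks G ε ξs z m = ((lambertInstant G ε ξs z (m + 1)).toReal,
      contactMarksOfPairs G ε (incomingPairs G ε (lambertPre G ε ξs z m)) (lambertPre G ε ξs z m)
        (ξs m)) := rfl

/-- The time mark of the `m`-th collision is the instant `t_{m+1}`. [folklore] -/
@[simp]
theorem lambertMarks_fst [Zero X] (ξs : ℕ → EuclideanSpace ℝ d) (z : Config N d X) (m : ℕ) :
    (lambertMarks G ε ξs z m).1 = (lambertInstant G ε ξs z (m + 1)).toReal := rfl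

/-- **On a simple incoming exit configuration the marks are those of the redrawn pair, and they
determine the post-collisional relative velocity**: if `τ(z_m) < ∞` and the incoming pairs of the
pre-collisional configuration `y = lambertPre … m` are exactly `{(i, j)}`, then the marks of the
`m`-th collision are `contactMarks G ε i j y (ξs m)` and in `z_{m+1}` the pair has relative velocity
`r_m • n_m`. [folklore] -/
theorem lambertMarks_snd_eq_of_incomingPairs_eq [Zero X] {ξs : ℕ → EuclideanSpace ℝ d}
    {z : Config N d X} {m : ℕ} {p : Fin N × Fin N}
    (hp : incomingPairs G ε (lambertPre G ε ξs z m) = {p}) :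
    (lambertMarks G ε ξs z m).2 = contactMarks G ε p.1 p.2 (lambertPre G ε ξs z m) (ξs m) := by
  rw [lambertMarks_def, hp, contactMarksOfPairs_singleton]

/-- See `lambertMarks_snd_eq_of_incomingPairs_eq`: the relative velocity of the redrawn pair in
`z_{m+1}` is `r_m • n_m`. [folklore] -/
theorem vel_sub_vel_lambertStateAfter_succ [Zero X] {ξs : ℕ → EuclideanSpace ℝ d} {z : Config N d X}
    {m : ℕ} (hτ : freeExitTime G ε (lambertStateAfter G ε ξs z m) ≠ ∞) {p : Fin N × Fin N}
    (hp : incomingPairs G ε (lambertPre G ε ξs z m) = {p}) :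
    (lambertStateAfter G ε ξs z (m + 1) p.1).2 - (lambertStateAfter G ε ξs z (m + 1) p.2).2 =
      (lambertMarks G ε ξs z m).2.2.2.1 • (lambertMarks G ε ξs z m).2.2.2.2.2 := by
  have hne : p.1 ≠ p.2 := by
    have hmem : p ∈ incomingPairs G ε (lambertPre G ε ξs z m) := hp ▸ mem_singleton p
    exact (mem_incomingPairs.1 hmem).1.ne
  rw [lambertStateAfter_succ_eq_lambertStepMap G ε hτ, hp, lambertStepMap_singleton,
    lambertMarks_snd_eq_of_incomingPairs_eq G ε hp]
  exact vel_sub_vel_lambertPair hne _ _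

end Marks

/-! ## Measurability of the marks, jointly in the datum and the noise -/

section Measurability

variable {d : Type*} [Fintype d] {X : Type*} {N : ℕ} [MeasurableSpace X] {G : Geometry d X}
  {ε : ℝ}

/-- The contact marks of a fixed pair are jointly measurable in `(y, ξ)` (measurable geometry).
[folklore] -/
theorem measurable_contactMarks (hGm : G.IsMeasurable) (i j : Fin N) :
    Measurable fun p : Config N d X × EuclideanSpace ℝ d => contactMarks G ε i j p.1 p.2 := by
  have hvi : Measurable fun p : Config N d X × EuclideanSpace ℝ d => (p.1 i).2 :=
    (Geometry.IsMeasurable.measurable_vel i).comp measurable_fst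
  have hvj : Measurable fun p : Config N d X × EuclideanSpace ℝ d => (p.1 j).2 :=
    (Geometry.IsMeasurable.measurable_vel j).comp measurable_fst
  have hxj : Measurable fun p : Config N d X × EuclideanSpace ℝ d => (p.1 j).1 :=
    (Geometry.IsMeasurable.measurable_pos j).comp measurable_fst
  have hn : Measurable fun p : Config N d X × EuclideanSpace ℝ d => G.sepVec (p.1 i).1 (p.1 j).1 :=
    (hGm.measurable_sepVec_config i j).comp measurable_fst
  refine (hGm.measurable_translate.comp (hxj.prodMk (hn.const_smul ((2 : ℝ)⁻¹)))).prodMk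
    (((hvi.add hvj).const_smul ((2 : ℝ)⁻¹)).prodMk ((hvi.sub hvj).norm.prodMk
      ((hn.const_smul (ε⁻¹ : ℝ)).prodMk (hn.lambertDir measurable_snd))))

/-- For a fixed set of pairs, the selected marks are jointly measurable in `(y, ξ)`. [folklore] -/
theorem measurable_contactMarksOfPairs [Zero X] (hGm : G.IsMeasurable) (S : Set (Fin N × Fin N)) :
    Measurable fun p : Config N d X × EuclideanSpace ℝ d => contactMarksOfPairs G ε S p.1 p.2 := by
  unfold contactMarksOfPairs
  split_ifs with h
  · exact measurable_contactMarks hGm _ _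
  · exact measurable_const

/-- `a ↦ contactMarksOfPairs G ε (incomingPairs G ε (w a)) (w a) (ξ a)` is measurable for
measurable `w`, `ξ`: the set of incoming pairs takes finitely many values on measurable level
sets (as in `measurable_lambertStepMap_incomingPairs`). [folklore] -/
theorem measurable_contactMarksOfPairs_incomingPairs [Zero X] {α : Type*} [MeasurableSpace α]
    (hGm : G.IsMeasurable) {w : α → Config N d X} (hw : Measurable w)
    {ξ : α → EuclideanSpace ℝ d} (hξ : Measurable ξ) :
    Measurable fun a => contactMarksOfPairs G ε (incomingPairs G ε (w a)) (w a) (ξ a) := by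
  letI : MeasurableSpace (Set (Fin N × Fin N)) := ⊤
  haveI : MeasurableSingletonClass (Set (Fin N × Fin N)) := ⟨fun _ => trivial⟩
  have hF : Measurable fun p : Set (Fin N × Fin N) × (Config N d X × EuclideanSpace ℝ d) =>
      contactMarksOfPairs G ε p.1 p.2.1 p.2.2 :=
    measurable_from_prod_countable_right fun S => measurable_contactMarksOfPairs hGm S
  have hS : Measurable fun a => incomingPairs G ε (w a) := by
    refine measurable_to_countable' fun S => ?_
    have hset : (fun a => incomingPairs G ε (w a)) ⁻¹' {S} =
        ⋂ p : Fin N × Fin N, {a | p ∈ incomingPairs G ε (w a) ↔ p ∈ S} := by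
      ext a
      simp only [mem_preimage, mem_singleton_iff, mem_iInter, mem_setOf_eq, Set.ext_iff]
    rw [hset]
    refine MeasurableSet.iInter fun p => measurableSet_setOf.2 ?_
    exact (measurableSet_setOf.1 ((measurableSet_mem_incomingPairs hGm p).preimage hw)).iff
      measurable_const
  exact hF.comp (hS.prodMk (hw.prodMk hξ))

variable [TopologicalSpace X]

/-- The pre-collisional configuration of the `(m+1)`-th collision is jointly measurable in
`(z, ξs)` (regular and measurable geometry). [folklore] -/
theorem measurable_lambertPre (hG : G.IsHardSphereRegular ε) (hGm : G.IsMeasurable) (m : ℕ) :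
    Measurable fun p : Config N d X × (ℕ → EuclideanSpace ℝ d) => lambertPre G ε p.2 p.1 m := by
  have hz : Measurable fun p : Config N d X × (ℕ → EuclideanSpace ℝ d) =>
      lambertStateAfter G ε p.2 p.1 m := measurable_lambertStateAfter hG hGm m
  exact hGm.measurable_freeFlight₂.comp
    (((measurable_freeExitTime hG hGm).comp hz).ennreal_toReal.prodMk hz)

/-- **The marks of the `m`-th collision are jointly measurable in `(z, ξs)`** (regular and
measurable geometry). [folklore] -/
theorem measurable_lambertMarks [Zero X] (hG : G.IsHardSphereRegular ε) (hGm : G.IsMeasurable)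
    (m : ℕ) :
    Measurable fun p : Config N d X × (ℕ → EuclideanSpace ℝ d) => lambertMarks G ε p.2 p.1 m :=
  (measurable_lambertInstant hG hGm (m + 1)).ennreal_toReal.prodMk
    (measurable_contactMarksOfPairs_incomingPairs hGm (measurable_lambertPre hG hGm m)
      ((measurable_pi_apply m).comp measurable_snd))

end Measurability

/-! ## The marked contact Campbell measure of the collisions in `[0, s]` -/

section Campbell

variable {d : Type*} [Fintype d] {X : Type*} {N : ℕ}

variable (G : Geometry d X) (ε : ℝ)

/-- The event "the `m`-th collision of the Lambertian trajectory happens in `[0, s]`":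
`t_{m+1} ≤ s`, as a subset of the sample space `Config × (ℕ → ℝ^d)` of (datum, noise). [folklore] -/
def lambertCollidesBy (s : ℝ) (m : ℕ) : Set (Config N d X × (ℕ → EuclideanSpace ℝ d)) :=
  {p | lambertInstant G ε p.2 p.1 (m + 1) ≤ ENNReal.ofReal s}

/-- Membership in `lambertCollidesBy`. [folklore] -/
theorem mem_lambertCollidesBy {s : ℝ} {m : ℕ} {p : Config N d X × (ℕ → EuclideanSpace ℝ d)} :
    p ∈ lambertCollidesBy G ε s m ↔ lambertInstant G ε p.2 p.1 (m + 1) ≤ ENNReal.ofReal s :=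
  Iff.rfl

variable [MeasurableSpace X] [Zero X]

/-- **The marked contact Campbell measure** of the Lambertian gas with initial law `μ` up to the
horizon `s`: the intensity measure `A ↦ E_{μ ⊗ γ^ℕ} #{m : t_{m+1} ≤ s, lambertMarks … m ∈ A}` of the
marked point process of the collisions in `[0, s]` (Last–Penrose, Def. 2.5), written as the sum
over `m` of the images of `(μ ⊗ lambertNoise d)|_{t_{m+1} ≤ s}` under the `m`-th marks
(`lambertCampbell_apply`). [cite: LastPenrose2017, Def. 2.5 and Prop. 2.7] -/
def lambertCampbell (μ : Measure (Config N d X)) (s : ℝ) : Measure (CollisionMarks d X) :=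
  Measure.sum fun m : ℕ =>
    ((μ.prod (lambertNoise d)).restrict (lambertCollidesBy G ε s m)).map
      fun p => lambertMarks G ε p.2 p.1 m

/-- **The weighted marked contact Campbell measure**: each collision in `[0, s]` is weighted by
`g(Λ_s(z, ξs)) ∈ [0, ∞]`, a function of the FINAL state of its trajectory —
`A ↦ E_{μ ⊗ γ^ℕ} ∑_{m : t_{m+1} ≤ s} 1_A(lambertMarks … m) g(Λ_s)` (Campbell's formula with weights,
Last–Penrose (13.1)); `g = 1` gives `lambertCampbell` (`lambertWeightedCampbell_one`).
[cite: LastPenrose2017, (13.1)] -/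
def lambertWeightedCampbell (μ : Measure (Config N d X)) (s : ℝ) (g : Config N d X → ℝ≥0∞) :
    Measure (CollisionMarks d X) :=
  Measure.sum fun m : ℕ =>
    (((μ.prod (lambertNoise d)).restrict (lambertCollidesBy G ε s m)).withDensity
        fun p => g (lambertFlow G ε p.2 p.1 s)).map
      fun p => lambertMarks G ε p.2 p.1 m

variable {G ε}

/-- The Campbell measure of an s-finite initial law is s-finite (a countable sum of images of
restrictions of the s-finite `μ ⊗ γ^ℕ`). [folklore] -/
instance sFinite_lambertCampbell (μ : Measure (Config N d X)) [SFinite μ] (s : ℝ) :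
    SFinite (lambertCampbell G ε μ s) := by
  unfold lambertCampbell
  infer_instance

/-- The weighted Campbell measures of an s-finite initial law are s-finite. [folklore] -/
instance sFinite_lambertWeightedCampbell (μ : Measure (Config N d X)) [SFinite μ] (s : ℝ)
    (g : Config N d X → ℝ≥0∞) : SFinite (lambertWeightedCampbell G ε μ s g) := by
  unfold lambertWeightedCampbell
  infer_instance

/-- With the weight `1` the weighted Campbell measure is the Campbell measure. [folklore] -/
@[simp]
theorem lambertWeightedCampbell_one (μ : Measure (Config N d X)) (s : ℝ) :
    lambertWeightedCampbell G ε μ s (fun _ => 1) = lambertCampbell G ε μ s := by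
  unfold lambertWeightedCampbell lambertCampbell
  congr 1
  funext m
  rw [show (fun _ : Config N d X × (ℕ → EuclideanSpace ℝ d) => (1 : ℝ≥0∞)) = 1 from rfl,
    withDensity_one]

variable [TopologicalSpace X]

omit [Zero X] in
/-- The event `t_{m+1} ≤ s` is measurable (regular and measurable geometry). [folklore] -/
theorem measurableSet_lambertCollidesBy (hG : G.IsHardSphereRegular ε) (hGm : G.IsMeasurable)
    (s : ℝ) (m : ℕ) : MeasurableSet (lambertCollidesBy G ε s m : Set (Config N d X × _)) :=
  measurableSet_le (measurable_lambertInstant hG hGm (m + 1)) measurable_const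

/-- **Campbell's formula for the marked contact Campbell measure** (indicator form):
`Γ(A) = ∑_m (μ ⊗ γ^ℕ){t_{m+1} ≤ s, marks_m ∈ A} = E #{m : t_{m+1} ≤ s, marks_m ∈ A}`.
[cite: LastPenrose2017, Def. 2.5 and Prop. 2.7] -/
theorem lambertCampbell_apply (hG : G.IsHardSphereRegular ε) (hGm : G.IsMeasurable)
    (μ : Measure (Config N d X)) (s : ℝ) {A : Set (CollisionMarks d X)} (hA : MeasurableSet A) :
    lambertCampbell G ε μ s A = ∑' m : ℕ, (μ.prod (lambertNoise d))
      ((fun p => lambertMarks G ε p.2 p.1 m) ⁻¹' A ∩ lambertCollidesBy G ε s m) := by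
  rw [lambertCampbell, Measure.sum_apply _ hA]
  congr 1
  funext m
  rw [Measure.map_apply (measurable_lambertMarks hG hGm m) hA,
    Measure.restrict_apply (hA.preimage (measurable_lambertMarks hG hGm m))]

/-- **Deterministic start** (`μ = δ_y`): the Campbell measure of the trajectory from `y` is
`A ↦ ∑_m γ^ℕ{ξs : t_{m+1} ≤ s, lambertMarks … ξs y m ∈ A}` — the intensity measure of the marked
collisions of the `ξ`-driven Lambertian trajectory from the fixed configuration `y`.
[cite: LastPenrose2017, Def. 2.5] -/
theorem lambertCampbell_dirac_apply [MeasurableSingletonClass (Config N d X)]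
    (hG : G.IsHardSphereRegular ε) (hGm : G.IsMeasurable) (y : Config N d X) (s : ℝ)
    {A : Set (CollisionMarks d X)} (hA : MeasurableSet A) :
    lambertCampbell G ε (Measure.dirac y) s A = ∑' m : ℕ, lambertNoise d
      {ξs | lambertMarks G ε ξs y m ∈ A ∧ lambertInstant G ε ξs y (m + 1) ≤ ENNReal.ofReal s} := by
  rw [lambertCampbell_apply hG hGm _ s hA]
  congr 1
  funext m
  rw [Measure.dirac_prod, Measure.map_apply measurable_prodMk_left
    ((hA.preimage (measurable_lambertMarks hG hGm m)).inter (measurableSet_lambertCollidesBy hG hGm s m))]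
  rfl

/-- **The total mass of the Campbell measure is the expected number of collisions in `[0, s]`**:
`Γ(univ) = ∑_m (μ ⊗ γ^ℕ){t_{m+1} ≤ s}`. [cite: LastPenrose2017, Def. 2.5] -/
theorem lambertCampbell_univ (hG : G.IsHardSphereRegular ε) (hGm : G.IsMeasurable)
    (μ : Measure (Config N d X)) (s : ℝ) :
    lambertCampbell G ε μ s univ = ∑' m : ℕ, (μ.prod (lambertNoise d)) (lambertCollidesBy G ε s m) := by
  rw [lambertCampbell_apply hG hGm μ s MeasurableSet.univ]
  simp only [preimage_univ, univ_inter]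

/-- The same, as the expectation of the collision number `∑_m 1{t_{m+1} ≤ s}`. [cite: LastPenrose2017, Def. 2.5] -/
theorem lambertCampbell_univ_eq_lintegral (hG : G.IsHardSphereRegular ε) (hGm : G.IsMeasurable)
    (μ : Measure (Config N d X)) [SFinite μ] (s : ℝ) :
    lambertCampbell G ε μ s univ =
      ∫⁻ p, ∑' m : ℕ, (lambertCollidesBy G ε s m).indicator 1 p ∂(μ.prod (lambertNoise d)) := by
  rw [lambertCampbell_univ hG hGm,
    lintegral_tsum fun m => (measurable_one.indicator (measurableSet_lambertCollidesBy hG hGm s m)).aemeasurable]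
  congr 1
  funext m
  rw [lintegral_indicator_one (measurableSet_lambertCollidesBy hG hGm s m)]

/-- Each event `t_{m+1} ≤ s` has mass at most the total Campbell mass. [folklore] -/
theorem measure_lambertCollidesBy_le (hG : G.IsHardSphereRegular ε) (hGm : G.IsMeasurable)
    (μ : Measure (Config N d X)) (s : ℝ) (m : ℕ) :
    (μ.prod (lambertNoise d)) (lambertCollidesBy G ε s m) ≤ lambertCampbell G ε μ s univ := by
  rw [lambertCampbell_univ hG hGm]
  exact ENNReal.le_tsum m

/-- **The Campbell measure is finite under a first-moment bound on the number of collisions in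
`[0, s]`** (for the routes: the item `CollisionMomentBound`). [cite: LastPenrose2017, Prop. 2.7] -/
theorem isFiniteMeasure_lambertCampbell (hG : G.IsHardSphereRegular ε) (hGm : G.IsMeasurable)
    (μ : Measure (Config N d X)) (s : ℝ)
    (h : ∑' m : ℕ, (μ.prod (lambertNoise d)) (lambertCollidesBy G ε s m) ≠ ∞) :
    IsFiniteMeasure (lambertCampbell G ε μ s) :=
  ⟨by rw [lambertCampbell_univ hG hGm]; exact h.lt_top⟩

/-- **Campbell's formula with weights**: `Γ_g(A) = ∑_m ∫_{t_{m+1} ≤ s, marks_m ∈ A} g(Λ_s) d(μ ⊗ γ^ℕ)`.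
[cite: LastPenrose2017, (13.1)] -/
theorem lambertWeightedCampbell_apply (hG : G.IsHardSphereRegular ε) (hGm : G.IsMeasurable)
    (μ : Measure (Config N d X)) (s : ℝ) (g : Config N d X → ℝ≥0∞) {A : Set (CollisionMarks d X)}
    (hA : MeasurableSet A) :
    lambertWeightedCampbell G ε μ s g A = ∑' m : ℕ,
      ∫⁻ p in (fun p => lambertMarks G ε p.2 p.1 m) ⁻¹' A ∩ lambertCollidesBy G ε s m,
        g (lambertFlow G ε p.2 p.1 s) ∂(μ.prod (lambertNoise d)) := by
  rw [lambertWeightedCampbell, Measure.sum_apply _ hA]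
  congr 1
  funext m
  rw [Measure.map_apply (measurable_lambertMarks hG hGm m) hA,
    withDensity_apply _ (hA.preimage (measurable_lambertMarks hG hGm m)),
    Measure.restrict_restrict (hA.preimage (measurable_lambertMarks hG hGm m))]

/-- **Domination**: if `g ≤ C` then `Γ_g ≤ C • Γ`. [folklore] -/
theorem lambertWeightedCampbell_le_smul (hG : G.IsHardSphereRegular ε) (hGm : G.IsMeasurable)
    (μ : Measure (Config N d X)) (s : ℝ) {g : Config N d X → ℝ≥0∞} {C : ℝ≥0∞} (hg : ∀ w, g w ≤ C) :
    lambertWeightedCampbell G ε μ s g ≤ C • lambertCampbell G ε μ s := by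
  refine Measure.le_iff.2 fun A hA => ?_
  rw [lambertWeightedCampbell_apply hG hGm μ s g hA, Measure.smul_apply, smul_eq_mul,
    lambertCampbell_apply hG hGm μ s hA, ← ENNReal.tsum_mul_left]
  refine ENNReal.tsum_le_tsum fun m => ?_
  rw [← setLIntegral_const]
  exact lintegral_mono fun p => hg _

/-- **Absolute continuity**: every weighted Campbell measure is absolutely continuous with respect
to the Campbell measure (each is a sum over `m` of images of measures with a density).
[folklore] -/
theorem lambertWeightedCampbell_absolutelyContinuous (hG : G.IsHardSphereRegular ε)
    (hGm : G.IsMeasurable) (μ : Measure (Config N d X)) (s : ℝ) (g : Config N d X → ℝ≥0∞) :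
    lambertWeightedCampbell G ε μ s g ≪ lambertCampbell G ε μ s := by
  refine Measure.AbsolutelyContinuous.mk fun A hA h0 => ?_
  rw [lambertCampbell, Measure.sum_apply _ hA, ENNReal.tsum_eq_zero] at h0
  rw [lambertWeightedCampbell, Measure.sum_apply _ hA, ENNReal.tsum_eq_zero]
  intro m
  exact ((withDensity_absolutelyContinuous _ _).map (measurable_lambertMarks hG hGm m)) (h0 m)

end Campbell

/-! ## The Campbell-conditional response kernel and the response signed measure -/

section Response

variable {d : Type*} [Fintype d] {X : Type*} {N : ℕ} [MeasurableSpace X] [Zero X]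

variable (G : Geometry d X) (ε : ℝ)

/-- **`Λ`'s own Campbell-conditional response kernel** `Ψ^Λ = Ψ^Λ_{μ, s, F} : CollisionMarks → ℝ` of
the real observable `F` of the final state: the Radon–Nikodym derivative
`d Γ_{F⁺} / d Γ - d Γ_{F⁻} / d Γ` of the Campbell measures weighted by the positive and negative
parts of `F(Λ_s)` with respect to the Campbell measure `Γ = lambertCampbell G ε μ s` — the
conditional mean of `F(Λ_s)` given that a collision with marks `(t, x, c, r, ω)` went out in the
direction `n` ("`Φ`'s contact environments produce `Λ`'s own collision-averaged responses").
Determined `Γ`-a.e.; it is the density of `lambertResponseMeasure`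
(`lambertResponseKernel_ae_eq_rnDeriv`, `lambertResponseMeasure_apply`).
[cite: Kallenberg2021, Ch. 31] -/
def lambertResponseKernel (μ : Measure (Config N d X)) (s : ℝ) (F : Config N d X → ℝ) :
    CollisionMarks d X → ℝ := fun x =>
  ((lambertWeightedCampbell G ε μ s (fun w => ENNReal.ofReal (F w))).rnDeriv
      (lambertCampbell G ε μ s) x).toReal -
    ((lambertWeightedCampbell G ε μ s (fun w => ENNReal.ofReal (-F w))).rnDeriv
      (lambertCampbell G ε μ s) x).toReal

/-- **The response signed measure** of the observable `F`: the Campbell measure with the signed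
density `Ψ^Λ`, i.e. (for bounded measurable `F` and a finite Campbell measure,
`lambertResponseMeasure_apply`) `A ↦ ∑_m E[1{t_{m+1} ≤ s, marks_m ∈ A} F(Λ_s)]`.
[cite: LastPenrose2017, (13.1)] -/
def lambertResponseMeasure (μ : Measure (Config N d X)) (s : ℝ) (F : Config N d X → ℝ) :
    SignedMeasure (CollisionMarks d X) :=
  (lambertCampbell G ε μ s).withDensityᵥ (lambertResponseKernel G ε μ s F)

variable {G ε}

/-- Unfolding lemma for `lambertResponseKernel`. [folklore] -/
theorem lambertResponseKernel_apply (μ : Measure (Config N d X)) (s : ℝ) (F : Config N d X → ℝ)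
    (x : CollisionMarks d X) :
    lambertResponseKernel G ε μ s F x =
      ((lambertWeightedCampbell G ε μ s (fun w => ENNReal.ofReal (F w))).rnDeriv
          (lambertCampbell G ε μ s) x).toReal -
        ((lambertWeightedCampbell G ε μ s (fun w => ENNReal.ofReal (-F w))).rnDeriv
          (lambertCampbell G ε μ s) x).toReal := rfl

/-- The response kernel is measurable. [folklore] -/
@[fun_prop]
theorem measurable_lambertResponseKernel (μ : Measure (Config N d X)) (s : ℝ)
    (F : Config N d X → ℝ) : Measurable (lambertResponseKernel G ε μ s F) :=
  (Measure.measurable_rnDeriv _ _).ennreal_toReal.sub (Measure.measurable_rnDeriv _ _).ennreal_toReal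

/-- **The response measure is absolutely continuous with respect to the Campbell measure.**
[folklore] -/
theorem lambertResponseMeasure_absolutelyContinuous (μ : Measure (Config N d X)) (s : ℝ)
    (F : Config N d X → ℝ) :
    lambertResponseMeasure G ε μ s F ≪ᵥ (lambertCampbell G ε μ s).toENNRealVectorMeasure :=
  Measure.withDensityᵥ_absolutelyContinuous _ _

/-- A Radon–Nikodym derivative with respect to `μ` of a measure dominated by `C • μ` is at most
`C`, `μ`-a.e. (the proof of `Measure.rnDeriv_le_one_of_le`, rescaled). [folklore] -/
theorem rnDeriv_le_const_ae {α : Type*} {_ : MeasurableSpace α} {ν μ : Measure α} [SigmaFinite μ]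
    {C : ℝ≥0∞} (h : ν ≤ C • μ) : ν.rnDeriv μ ≤ᵐ[μ] fun _ => C := by
  refine ae_le_of_forall_setLIntegral_le_of_sigmaFinite (ν.measurable_rnDeriv μ) fun s _ _ => ?_
  rw [setLIntegral_const]
  exact (Measure.setLIntegral_rnDeriv_le s).trans ((h s).trans_eq (by rw [Measure.smul_apply, smul_eq_mul]))

variable [TopologicalSpace X]

/-- The two Radon–Nikodym parts of the kernel are at most `C`, `Γ`-a.e., when `|F| ≤ C` and the
Campbell measure is finite. [folklore] -/
theorem rnDeriv_lambertWeightedCampbell_ofReal_le_ae (hG : G.IsHardSphereRegular ε)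
    (hGm : G.IsMeasurable) (μ : Measure (Config N d X)) (s : ℝ)
    [IsFiniteMeasure (lambertCampbell G ε μ s)] {F : Config N d X → ℝ} {C : ℝ}
    (hF : ∀ w, F w ≤ C) :
    (lambertWeightedCampbell G ε μ s (fun w => ENNReal.ofReal (F w))).rnDeriv
        (lambertCampbell G ε μ s) ≤ᵐ[lambertCampbell G ε μ s] fun _ => ENNReal.ofReal C :=
  rnDeriv_le_const_ae (lambertWeightedCampbell_le_smul hG hGm μ s fun w =>
    ENNReal.ofReal_le_ofReal (hF w))

/-- **`|Ψ^Λ| ≤ sup |F|`, `Γ`-almost everywhere** (bounded observable, finite Campbell measure).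
[folklore] -/
theorem abs_lambertResponseKernel_le_ae (hG : G.IsHardSphereRegular ε) (hGm : G.IsMeasurable)
    (μ : Measure (Config N d X)) (s : ℝ) [IsFiniteMeasure (lambertCampbell G ε μ s)]
    {F : Config N d X → ℝ} {C : ℝ} (hC : 0 ≤ C) (hF : ∀ w, |F w| ≤ C) :
    ∀ᵐ x ∂lambertCampbell G ε μ s, |lambertResponseKernel G ε μ s F x| ≤ C := by
  filter_upwards [rnDeriv_lambertWeightedCampbell_ofReal_le_ae hG hGm μ s fun w => (abs_le.1 (hF w)).2,
    rnDeriv_lambertWeightedCampbell_ofReal_le_ae hG hGm μ s (F := fun w => -F w)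
      fun w => (abs_le.1 (abs_neg (F w) ▸ hF w)).2] with x h₁ h₂
  have h₁' := ENNReal.toReal_le_of_le_ofReal hC h₁
  have h₂' := ENNReal.toReal_le_of_le_ofReal hC h₂
  rw [lambertResponseKernel_apply, abs_sub_le_iff]
  exact ⟨(sub_le_self _ ENNReal.toReal_nonneg).trans h₁', (sub_le_self _ ENNReal.toReal_nonneg).trans h₂'⟩

/-- The response kernel of a bounded observable is integrable against a finite Campbell measure.
[folklore] -/
theorem integrable_lambertResponseKernel (hG : G.IsHardSphereRegular ε) (hGm : G.IsMeasurable)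
    (μ : Measure (Config N d X)) (s : ℝ) [IsFiniteMeasure (lambertCampbell G ε μ s)]
    {F : Config N d X → ℝ} {C : ℝ} (hC : 0 ≤ C) (hF : ∀ w, |F w| ≤ C) :
    Integrable (lambertResponseKernel G ε μ s F) (lambertCampbell G ε μ s) :=
  (integrable_const C).mono' (measurable_lambertResponseKernel μ s F).aestronglyMeasurable
    ((abs_lambertResponseKernel_le_ae hG hGm μ s hC hF).mono fun x hx => by
      rwa [Real.norm_eq_abs])

/-- The Radon–Nikodym part of a weight `g ≤ C < ∞` is integrable (as a real function) against a
finite Campbell measure. [folklore] -/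
theorem integrable_toReal_rnDeriv_lambertWeightedCampbell (hG : G.IsHardSphereRegular ε)
    (hGm : G.IsMeasurable) (μ : Measure (Config N d X)) (s : ℝ)
    [IsFiniteMeasure (lambertCampbell G ε μ s)] {g : Config N d X → ℝ≥0∞} {C : ℝ≥0∞} (hC : C ≠ ∞)
    (hg : ∀ w, g w ≤ C) :
    Integrable (fun x => ((lambertWeightedCampbell G ε μ s g).rnDeriv (lambertCampbell G ε μ s) x).toReal)
      (lambertCampbell G ε μ s) := by
  refine integrable_toReal_of_lintegral_ne_top (Measure.measurable_rnDeriv _ _).aemeasurable ?_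
  refine ne_top_of_le_ne_top ?_ Measure.lintegral_rnDeriv_le
  refine ne_top_of_le_ne_top ?_ (lambertWeightedCampbell_le_smul hG hGm μ s hg univ)
  rw [Measure.smul_apply, smul_eq_mul]
  exact ENNReal.mul_ne_top hC (measure_ne_top _ _)

/-- `∫_A (dΓ_g/dΓ) dΓ = Γ_g(A)` in real numbers, for a weight `g ≤ C < ∞`, an s-finite initial law
and a finite Campbell measure. [folklore] -/
theorem setIntegral_toReal_rnDeriv_lambertWeightedCampbell (hG : G.IsHardSphereRegular ε)
    (hGm : G.IsMeasurable) (μ : Measure (Config N d X)) [SFinite μ] (s : ℝ)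
    [IsFiniteMeasure (lambertCampbell G ε μ s)] {g : Config N d X → ℝ≥0∞} {C : ℝ≥0∞} (hC : C ≠ ∞)
    (hg : ∀ w, g w ≤ C) (A : Set (CollisionMarks d X)) :
    ∫ x in A, ((lambertWeightedCampbell G ε μ s g).rnDeriv (lambertCampbell G ε μ s) x).toReal
        ∂(lambertCampbell G ε μ s) = (lambertWeightedCampbell G ε μ s g A).toReal := by
  rw [integral_toReal (Measure.measurable_rnDeriv _ _).aemeasurable]
  · rw [Measure.setLIntegral_rnDeriv (lambertWeightedCampbell_absolutelyContinuous hG hGm μ s g) A]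
  · exact ae_restrict_of_ae ((rnDeriv_le_const_ae (lambertWeightedCampbell_le_smul hG hGm μ s hg)).mono
      fun x hx => lt_of_le_of_lt hx hC.lt_top)

/-- **The Campbell response formula** — the formula by which the item DEFINES the response
measure: for an s-finite initial law, a finite Campbell measure (finite expected number of
collisions in `[0, s]`), a bounded measurable observable `F` and a measurable set `A` of marks,
`lambertResponseMeasure … F A = ∑_m ∫_{marks_m ∈ A, t_{m+1} ≤ s} F(Λ_s(z, ξs)) d(μ ⊗ γ^ℕ)(z, ξs)`
(every term and the series converge absolutely). [cite: LastPenrose2017, Prop. 2.7 and (13.1)] -/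
theorem lambertResponseMeasure_apply (hG : G.IsHardSphereRegular ε) (hGm : G.IsMeasurable)
    (μ : Measure (Config N d X)) [SFinite μ] (s : ℝ) [IsFiniteMeasure (lambertCampbell G ε μ s)]
    {F : Config N d X → ℝ} (hFm : Measurable F) {C : ℝ} (hC : 0 ≤ C) (hF : ∀ w, |F w| ≤ C)
    {A : Set (CollisionMarks d X)} (hA : MeasurableSet A) :
    lambertResponseMeasure G ε μ s F A = ∑' m : ℕ,
      ∫ p in (fun p => lambertMarks G ε p.2 p.1 m) ⁻¹' A ∩ lambertCollidesBy G ε s m,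
        F (lambertFlow G ε p.2 p.1 s) ∂(μ.prod (lambertNoise d)) := by
  have hF₁ : ∀ w, ENNReal.ofReal (F w) ≤ ENNReal.ofReal C := fun w =>
    ENNReal.ofReal_le_ofReal ((abs_le.1 (hF w)).2)
  have hF₂ : ∀ w, ENNReal.ofReal (-F w) ≤ ENNReal.ofReal C := fun w =>
    ENNReal.ofReal_le_ofReal ((abs_le.1 (abs_neg (F w) ▸ hF w)).2)
  have hint₁ := integrable_toReal_rnDeriv_lambertWeightedCampbell hG hGm μ s ENNReal.ofReal_ne_top hF₁
  have hint₂ := integrable_toReal_rnDeriv_lambertWeightedCampbell hG hGm μ s ENNReal.ofReal_ne_top hF₂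
  -- finiteness of the two weighted Campbell measures on `A`
  have hne : ∀ {g : Config N d X → ℝ≥0∞}, (∀ w, g w ≤ ENNReal.ofReal C) →
      lambertWeightedCampbell G ε μ s g A ≠ ∞ := by
    intro g hg
    refine ne_top_of_le_ne_top ?_ (lambertWeightedCampbell_le_smul hG hGm μ s hg A)
    rw [Measure.smul_apply, smul_eq_mul]
    exact ENNReal.mul_ne_top ENNReal.ofReal_ne_top (measure_ne_top _ _)
  have hne₁ := hne hF₁
  have hne₂ := hne hF₂
  rw [lambertWeightedCampbell_apply hG hGm μ s _ hA] at hne₁ hne₂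
  -- the response measure as the difference of the two Radon–Nikodym integrals
  rw [lambertResponseMeasure, withDensityᵥ_apply (integrable_lambertResponseKernel hG hGm μ s hC hF) hA]
  have hsub : ∫ x in A, lambertResponseKernel G ε μ s F x ∂lambertCampbell G ε μ s =
      ∫ x in A, ((lambertWeightedCampbell G ε μ s (fun w => ENNReal.ofReal (F w))).rnDeriv
          (lambertCampbell G ε μ s) x).toReal ∂lambertCampbell G ε μ s -
        ∫ x in A, ((lambertWeightedCampbell G ε μ s (fun w => ENNReal.ofReal (-F w))).rnDeriv
          (lambertCampbell G ε μ s) x).toReal ∂lambertCampbell G ε μ s :=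
    integral_sub hint₁.integrableOn hint₂.integrableOn
  rw [hsub, setIntegral_toReal_rnDeriv_lambertWeightedCampbell hG hGm μ s ENNReal.ofReal_ne_top hF₁ A,
    setIntegral_toReal_rnDeriv_lambertWeightedCampbell hG hGm μ s ENNReal.ofReal_ne_top hF₂ A,
    lambertWeightedCampbell_apply hG hGm μ s _ hA, lambertWeightedCampbell_apply hG hGm μ s _ hA,
    ENNReal.tsum_toReal_eq (fun m => ne_top_of_le_ne_top hne₁ (ENNReal.le_tsum m)),
    ENNReal.tsum_toReal_eq (fun m => ne_top_of_le_ne_top hne₂ (ENNReal.le_tsum m)),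
    ← (ENNReal.summable_toReal hne₁).tsum_sub (ENNReal.summable_toReal hne₂)]
  refine tsum_congr fun m => ?_
  -- termwise: `(∫⁻ F⁺).toReal - (∫⁻ F⁻).toReal = ∫ F` on the finite measure `(μ ⊗ γ^ℕ)|_{A_m}`
  have hAm : (μ.prod (lambertNoise d))
      ((fun p => lambertMarks G ε p.2 p.1 m) ⁻¹' A ∩ lambertCollidesBy G ε s m) ≠ ∞ :=
    ne_top_of_le_ne_top (measure_ne_top _ _)
      ((measure_mono inter_subset_right).trans (measure_lambertCollidesBy_le hG hGm μ s m))
  haveI : IsFiniteMeasure ((μ.prod (lambertNoise d)).restrict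
      ((fun p => lambertMarks G ε p.2 p.1 m) ⁻¹' A ∩ lambertCollidesBy G ε s m)) :=
    ⟨by rw [Measure.restrict_apply_univ]; exact hAm.lt_top⟩
  have hI : Integrable (fun p : Config N d X × (ℕ → EuclideanSpace ℝ d) => F (lambertFlow G ε p.2 p.1 s))
      ((μ.prod (lambertNoise d)).restrict
        ((fun p => lambertMarks G ε p.2 p.1 m) ⁻¹' A ∩ lambertCollidesBy G ε s m)) :=
    (integrable_const C).mono' (hFm.comp (measurable_lambertFlow hG hGm s)).aestronglyMeasurable
      (Eventually.of_forall fun p => by rw [Real.norm_eq_abs]; exact hF _)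
  rw [integral_eq_lintegral_pos_part_sub_lintegral_neg_part hI]

/-- **The kernel IS the Radon–Nikodym derivative of the response measure with respect to the
Campbell measure** (`Γ`-a.e.; bounded observable, finite Campbell measure). [folklore] -/
theorem lambertResponseKernel_ae_eq_rnDeriv (hG : G.IsHardSphereRegular ε) (hGm : G.IsMeasurable)
    (μ : Measure (Config N d X)) (s : ℝ) [IsFiniteMeasure (lambertCampbell G ε μ s)]
    {F : Config N d X → ℝ} {C : ℝ} (hC : 0 ≤ C) (hF : ∀ w, |F w| ≤ C) :
    lambertResponseKernel G ε μ s F =ᵐ[lambertCampbell G ε μ s]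
      (lambertResponseMeasure G ε μ s F).rnDeriv (lambertCampbell G ε μ s) := by
  have hint := integrable_lambertResponseKernel hG hGm μ s hC hF
  refine hint.ae_eq_of_withDensityᵥ_eq (SignedMeasure.integrable_rnDeriv _ _) ?_
  rw [SignedMeasure.withDensityᵥ_rnDeriv_eq _ _ (lambertResponseMeasure_absolutelyContinuous μ s F)]
  rfl

end Response

/-! ## The torus at fixed reduced density (the setting of the routes) -/

section Torus

variable {N : ℕ}

/-- **Measurability of the collision marks of `N + 1` spheres of diameter `hsDiameter σ N` on
`𝕋³`**, `0 ≤ σ < 1/2`, jointly in `(z, ξs)` — the hypotheses `hG`, `hGm` of this file discharged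
for `G = Torus.geometry (Fin 3)`, `ε = hsDiameter σ N` (and the junk `[Zero (UnitAddTorus (Fin 3))]`
inhabited). [folklore] -/
theorem measurable_lambertMarks_hsDiameter {σ : ℝ} (hσ : 0 ≤ σ) (hσ' : σ < 2⁻¹) (N m : ℕ) :
    Measurable fun p : Config (N + 1) (Fin 3) (UnitAddTorus (Fin 3)) × (ℕ → EuclideanSpace ℝ (Fin 3)) =>
      lambertMarks (Torus.geometry (Fin 3)) (hsDiameter σ N) p.2 p.1 m :=
  measurable_lambertMarks (Torus.isHardSphereRegular_geometry ((hsDiameter_le hσ N).trans_lt hσ'))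
    Torus.isMeasurable_geometry m

/-- **The Campbell response formula on `𝕋³` at fixed reduced density**, for a probability law `P`
of the initial datum (e.g. `localGibbsLaw …`), a finite Campbell measure, a bounded measurable
observable and a measurable set of marks. [cite: LastPenrose2017, Prop. 2.7 and (13.1)] -/
theorem lambertResponseMeasure_apply_hsDiameter {σ : ℝ} (hσ : 0 ≤ σ) (hσ' : σ < 2⁻¹) (N : ℕ)
    (P : Measure (Config (N + 1) (Fin 3) (UnitAddTorus (Fin 3)))) [SFinite P] (s : ℝ)
    [IsFiniteMeasure (lambertCampbell (Torus.geometry (Fin 3)) (hsDiameter σ N) P s)]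
    {F : Config (N + 1) (Fin 3) (UnitAddTorus (Fin 3)) → ℝ} (hFm : Measurable F) {C : ℝ}
    (hC : 0 ≤ C) (hF : ∀ w, |F w| ≤ C) {A : Set (CollisionMarks (Fin 3) (UnitAddTorus (Fin 3)))}
    (hA : MeasurableSet A) :
    lambertResponseMeasure (Torus.geometry (Fin 3)) (hsDiameter σ N) P s F A = ∑' m : ℕ,
      ∫ p in (fun p => lambertMarks (Torus.geometry (Fin 3)) (hsDiameter σ N) p.2 p.1 m) ⁻¹' A ∩
          lambertCollidesBy (Torus.geometry (Fin 3)) (hsDiameter σ N) s m,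
        F (lambertFlow (Torus.geometry (Fin 3)) (hsDiameter σ N) p.2 p.1 s)
          ∂(P.prod (lambertNoise (Fin 3))) :=
  lambertResponseMeasure_apply
    (Torus.isHardSphereRegular_geometry ((hsDiameter_le hσ N).trans_lt hσ'))
    Torus.isMeasurable_geometry P s hFm hC hF hA

end Torus

end Literature.MathematicalPhysics.KineticTheory

end
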